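import Mathlib

/-!
# `Balaban1983to89.B14Eq116QuadraticForm` — [Balaban1988Convergent] (1.14)–(1.16) pp. 249–250: the quadratic form
`⟨A, Δ₁A⟩` of the fluctuation integral and «the potentially dangerous linear term (1/g₀²)⟨A, J₁⟩ vanishes»

HONEST FRAMING (cell `lit-balaban`, verbatim): statement-level skeleton of published theorems with citation tags;
proofs where landed; nothing here is a claim about the Yang–Mills mass gap.

CITATION HEADER.  T. Bałaban, *Convergent renormalization expansions for lattice gauge theories*, Commun. Math.
Phys. **119** (1988) 243–285, doi:10.1007/bf01217741 [Balaban1988Convergent] (cell paper B14 = "[III]"; held text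
`paper:balaban1988-cmp119-convergent-renormalization`, journal page = PDF page + 242; (1.14)–(1.16) READ AS AN IMAGE
from the page render `b2b-balaban-ref1/pages/1988-cmp119-convergent-renormalization/…-p007-x2.png` (p. 249), the
remark from `…-p008-x2.png` (p. 250)).  Unit `lit-balaban-r11` (reader/typer of B14), SKELETON row `B14.Eq1.14–1.16`
(the operator C of p. 249 is `T4AdjointCovarianceWords.solveC`/`axialC`, PROVED there; the k-level representation is
row `B14.Eq3.15`, `B14.Eq315Repr`; THIS file: the two pieces of (1.14)–(1.16) that carry a computation — the
identification (1.16) of the quadratic form, and the vanishing of the linear term at the critical point).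

WHAT IS PRINTED.  (1.14) p. 249 [PDF 7]: the exponent of the fluctuation integral contains
*«− (1/g₀²){⟨A − hD̃(A), J₁⟩ + ½⟨A − hD̃(A), Δ(A − hD̃(A))⟩ + V₀(A − hD̃(A))}»* together with
*«− (1/g₀²)G(A − hD̃(A))»* and *«Tr log(I − h(δD̃/δA)(A))»*; after the scaling A = g₀A′ and the solution A′ = CA of
(Q̃A′)(c) = 0, (1.15) displays *«exp[−½⟨A, C*Δ₁CA⟩ + v(g₀CA) − (1/g₀²)V(g₀CA)]»* *«where
⟨A, Δ₁A⟩ = ⟨A, ΔA⟩ − 2⟨hC^{(2)}(A), J₁⟩ + G^{(2)}(A), (1.16) and v(A), V(A) have the same meaning as in (27) [16],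
i.e. v(A) is the sum of the first two terms under the second exponential in (1.15), and V(A) is the sum of the
remaining terms of the order higher than 2.»*  p. 250 [PDF 8]: *«Let us remark that it is very important for our
method, as it was in [16, I], that we expand in (1.14) around the critical point, so the potentially dangerous linear
term (1/g₀²)⟨A, J₁⟩ vanishes on the domain of integration.»*

HOW IT IS FORMALIZED.  (§1) **(1.16) is degree-2 bookkeeping.**  With `ℓ(B) = ⟨B, J₁⟩` linear, `q(B, B′) = ⟨B, ΔB′⟩`
bilinear, `h` linear and `C^{(2)}(A)` the quadratic (leading) part of the linearizing map D̃ (D̃(tA) = t²C^{(2)}(A) +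
higher order; the linearizing transformation starts at second order, its first-order part being the identity —
p. 249 «the linearizing transformation is different from the identity only on bonds {b₀(c)}»), the function
`t ↦ ⟨tA − t²hC^{(2)}(A), J₁⟩ + ½⟨tA − t²hC^{(2)}(A), Δ(tA − t²hC^{(2)}(A))⟩` is the explicit quartic polynomial
`t⟨A, J₁⟩ + t²·½[⟨A, ΔA⟩ − 2⟨hC^{(2)}(A), J₁⟩] + t³(…) + t⁴(…)` (`eq116_expansion`), so its quadratic part is
`½[⟨A, ΔA⟩ − 2⟨hC^{(2)}(A), J₁⟩]`, to which the gauge-fixing term contributes its own quadratic part `½G^{(2)}(A)`: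
together `½⟨A, Δ₁A⟩` with (1.16)'s `⟨A, Δ₁A⟩ := ⟨A, ΔA⟩ − 2⟨hC^{(2)}(A), J₁⟩ + G^{(2)}(A)` (`delta1Form`,
`eq116_quadratic_part`).  (§2) **The linear term vanishes at the critical point.**  If `f` (in print U ↦ A(U), the
Wilson action) has a minimum on a set `S` (the constraint surface {Ū = V} of [I] (1.8)) at `u = U₁`, and a curve
`γ` with `γ(0) = U₁` stays in `S` (in print `γ(t) = U₁ exp i(tA − hD̃(tA))` for A on the domain of integration
Q̃A = 0 — this is what the linearizing transformation is for), then the derivative of `f ∘ γ` at 0 vanishes: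
`Df(U₁)[γ′(0)] = 0`, i.e. `⟨A, J₁⟩ = 0` since γ′(0) is the direction A (D̃ has no linear part)
(`linear_term_vanishes`, `linear_term_vanishes_of_isMinOn`; Mathlib's `IsLocalMin.hasDerivAt_eq_zero`).

WHAT IS PROVED (kernel-checked, no `sorry`, standard axioms): everything below.  One definition: `delta1Form`.

WHAT IS NOT PROVED HERE (and not claimed): the displays (1.14)–(1.15) themselves (representation formulas — the
k-level carrier is `B14.Eq315Repr`), the existence and the expansion of the linearizing map D̃ and of G ([16] = B10,
(14)–(18), (27)), the minimizing property of U₁ ([I] (1.8), B11) — all entered as the hypotheses named above.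
NOT summit progress: bookkeeping of one printed definition and one printed remark.
-/

namespace Literature.MathematicalPhysics.QuantumFieldTheory.Balaban1983to89.B14.Eq116QuadraticForm

open Filter
open _root_.Topology

/-! ## §1. (1.16): the quadratic form `⟨A, Δ₁A⟩` -/

section Quadratic

variable {E : Type*} [AddCommGroup E] [Module ℝ E]

/-- **(1.16)** p. 249: `⟨A, Δ₁A⟩ := ⟨A, ΔA⟩ − 2⟨hC^{(2)}(A), J₁⟩ + G^{(2)}(A)` — from the pairing with the current
`ℓ = ⟨·, J₁⟩`, the Hessian form `q = ⟨·, Δ·⟩`, the operator `h`, the quadratic part `C2` of the linearizing map and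
the quadratic part `G2` of the gauge-fixing term. [cite: Balaban1988Convergent, (1.16) p.249] -/
def delta1Form (ℓ : E →ₗ[ℝ] ℝ) (q : E →ₗ[ℝ] E →ₗ[ℝ] ℝ) (h : E →ₗ[ℝ] E) (C2 : E → E) (G2 : E → ℝ) (A : E) : ℝ :=
  q A A - 2 * ℓ (h (C2 A)) + G2 A

/-- **(1.14) ⇒ (1.16), the expansion in the field strength parameter**: for every `t`,
`⟨tA − t²hC^{(2)}(A), J₁⟩ + ½⟨tA − t²hC^{(2)}(A), Δ(tA − t²hC^{(2)}(A))⟩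
 = t⟨A, J₁⟩ + t²·½[⟨A, ΔA⟩ − 2⟨hC^{(2)}(A), J₁⟩] − t³·½[⟨A, ΔhC^{(2)}(A)⟩ + ⟨hC^{(2)}(A), ΔA⟩]
   + t⁴·½⟨hC^{(2)}(A), ΔhC^{(2)}(A)⟩` — an exact polynomial identity (bilinearity).
[cite: Balaban1988Convergent, (1.14)-(1.16) p.249] -/
theorem eq116_expansion (ℓ : E →ₗ[ℝ] ℝ) (q : E →ₗ[ℝ] E →ₗ[ℝ] ℝ) (h : E →ₗ[ℝ] E) (C2 : E → E) (A : E) (t : ℝ) :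
    ℓ (t • A - t ^ 2 • h (C2 A)) + 2⁻¹ * q (t • A - t ^ 2 • h (C2 A)) (t • A - t ^ 2 • h (C2 A))
      = t * ℓ A + t ^ 2 * (2⁻¹ * (q A A - 2 * ℓ (h (C2 A))))
        - t ^ 3 * (2⁻¹ * (q A (h (C2 A)) + q (h (C2 A)) A))
        + t ^ 4 * (2⁻¹ * q (h (C2 A)) (h (C2 A))) := by
  simp only [map_sub, map_smul, LinearMap.sub_apply, LinearMap.smul_apply, smul_eq_mul]
  ring

/-- **(1.16), the quadratic part**: the coefficient of `t²` in the expansion of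
`⟨B, J₁⟩ + ½⟨B, ΔB⟩ + ½G(B)` along `B = tA − hD̃(tA)`, `D̃(tA) = t²C^{(2)}(A) + …`, `G(tA − …) = t²G^{(2)}(A) + …`,
is `½⟨A, Δ₁A⟩` — i.e. with the quadratic part of the gauge-fixing term added to `eq116_expansion`'s
`t²`-coefficient one gets `½·delta1Form`. [cite: Balaban1988Convergent, (1.16) p.249] -/
theorem eq116_quadratic_part (ℓ : E →ₗ[ℝ] ℝ) (q : E →ₗ[ℝ] E →ₗ[ℝ] ℝ) (h : E →ₗ[ℝ] E) (C2 : E → E)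
    (G2 : E → ℝ) (A : E) :
    2⁻¹ * (q A A - 2 * ℓ (h (C2 A))) + 2⁻¹ * G2 A = 2⁻¹ * delta1Form ℓ q h C2 G2 A := by
  unfold delta1Form
  ring

/-- On the domain of integration the linear term is absent (`⟨A, J₁⟩ = 0`, §2), so the expansion of
`eq116_expansion` STARTS with the quadratic form: its value is `t²·½[…] + O(t³)` exactly.
[cite: Balaban1988Convergent, (1.16) p.249, p.250] -/
theorem eq116_expansion_of_critical (ℓ : E →ₗ[ℝ] ℝ) (q : E →ₗ[ℝ] E →ₗ[ℝ] ℝ) (h : E →ₗ[ℝ] E) (C2 : E → E)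
    (A : E) (hJ : ℓ A = 0) (t : ℝ) :
    ℓ (t • A - t ^ 2 • h (C2 A)) + 2⁻¹ * q (t • A - t ^ 2 • h (C2 A)) (t • A - t ^ 2 • h (C2 A))
      = t ^ 2 * (2⁻¹ * (q A A - 2 * ℓ (h (C2 A))))
        - t ^ 3 * (2⁻¹ * (q A (h (C2 A)) + q (h (C2 A)) A))
        + t ^ 4 * (2⁻¹ * q (h (C2 A)) (h (C2 A))) := by
  rw [eq116_expansion, hJ, mul_zero, zero_add]

end Quadratic

/-! ## §2. p. 250: «we expand in (1.14) around the critical point, so the potentially dangerous linear term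
(1/g₀²)⟨A, J₁⟩ vanishes on the domain of integration» -/

section Critical

variable {F : Type*} [NormedAddCommGroup F] [NormedSpace ℝ F]

/-- **The linear term vanishes at a constrained critical point**, one-variable form: if `g = f ∘ γ` (the action
along a curve in the constraint surface through the minimizer) has a minimum at `0` among all `t` and is
differentiable there with derivative `g′`, then `g′ = 0`. [cite: Balaban1988Convergent, p.250 (remark after (1.16))] -/
theorem linear_term_vanishes {g : ℝ → ℝ} {g' : ℝ} (hmin : ∀ t, g 0 ≤ g t) (hg : HasDerivAt g g' 0) :
    g' = 0 := by
  have hloc : IsLocalMin g 0 := Filter.Eventually.of_forall hmin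
  exact hloc.hasDerivAt_eq_zero hg

/-- **«we expand … around the critical point, so the … linear term ⟨A, J₁⟩ vanishes on the domain of
integration»**: let `f` (print: U ↦ A(U)) attain its minimum on the set `S` (the constraint surface {Ū = V}) at
`u` (= U₁, [I] (1.8)), and let `γ` be a curve with `γ(0) = u`, `γ(t) ∈ S` for all `t` (print:
`γ(t) = U₁ exp i(tA − hD̃(tA))`, A on the domain Q̃A = 0) with velocity `v = γ′(0)` (= the direction of A, D̃ having no
linear part); if `f` is differentiable at `u` with derivative `f′` (the current: `f′ w = ⟨w, J₁⟩`), then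
`f′ v = 0` — the linear term of the expansion (1.14) vanishes. [cite: Balaban1988Convergent, p.250 (remark after (1.16))] -/
theorem linear_term_vanishes_of_isMinOn {f : F → ℝ} {S : Set F} {u v : F} {f' : F →L[ℝ] ℝ}
    (hmin : IsMinOn f S u) (γ : ℝ → F) (hγ0 : γ 0 = u) (hγS : ∀ t, γ t ∈ S) (hγ : HasDerivAt γ v 0)
    (hf : HasFDerivAt f f' u) : f' v = 0 := by
  have hcomp : HasDerivAt (f ∘ γ) (f' v) 0 := by
    have hf0 : HasFDerivAt f f' (γ 0) := by rw [hγ0]; exact hf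
    exact hf0.comp_hasDerivAt 0 hγ
  refine linear_term_vanishes (fun t => ?_) hcomp
  simp only [Function.comp_apply, hγ0]
  exact hmin (hγS t)

end Critical

end Literature.MathematicalPhysics.QuantumFieldTheory.Balaban1983to89.B14.Eq116QuadraticForm
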